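import Summits.QuantumFields.BalabanUV.T4Continuum.Spine.NE1p.DressedSmallFieldNestedToriRod
import Summits.QuantumFields.BalabanUV.T4Continuum.Spine.NE1p.DressedSmallFieldNestedToriWitnessLive

/-!
# T⁴ programme, spine estimate NE1′ (node O3b/H2) — THE (2.36) TRANSFER IS EXERCISED: S44's NESTED-TORI END FIRES ON A DECIDED TWO-SCALE DATUM
# WHOSE FINE COMPONENT IS THE THREE-CUBE ROD OF TREE LENGTH ONE (PART 2 of row W67; the END, the price of the transfer, liveness)

Cell `pub-balaban`, sub-cell `t4`, BINDER-OWNERS row NE1′ (owner skeleton `t4/skeletons/NE1p-t4-ne1p-p1.md` §3 N0u∕N0v∕N0w, pv22's nested tori);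
crew `b2b-balaban-t4-ne1p-formalise-*`, row **W67 ∕ DAG N29zzzt** of `t4/formal/NE1p/LEAVES.md` (RESERVED by typer RULING R-T137, CLAIMS.log l.22015, on INTENT
l.21891; booked at PROTOTYPE + STAGED & READY l.22071; the follower typer RULING R-T133 (ii)(a) named when booking W59), unit
`b2b-balaban-t4-ne1p-formalise-leaf-10` (gen 11).  ADDITIVE — imports PART 1 `Spine/NE1p/DressedSmallFieldNestedToriRod` (the rod
`C_R`, `tclosureDom_CR`, `torusTreeLen_CR = 1`) and W59.2 `Spine/NE1p/DressedSmallFieldNestedToriWitnessLive` (p237504; for W59.1's rates and clause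
equalities `rN`∕`RN`∕`vN`∕`R₀N`∕`εN`∕`hκ_N_eq`∕`hRR_N_eq`∕`hrate2_N_eq`∕`hκR_N`∕`h229_N_eq`∕`hsmall_N`∕`mN`∕`hinner_N_eq`∕`LabelN`∕`uncoveredN`∕`majN`∕`cN`∕`GN`
and W59.2's `εN_le_one`∕`vN_le` BY NAME) ONLY; THEOREMS ONLY (+ one closing `example`); S44's END
`DressedSmallFieldNestedTori.attachedPart_locE_le_of_coresAt_pencil_components_nestedTori` applied EXACTLY ONCE BY NAME (`nestedToriRodEnd_fires`);
nothing of S44 ∕ W59 ∕ pv22 restated.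

WHAT THIS FILE IS (a DECIDED applier, every `5 ≤ L`, every `N′`):
* §1 the inner weight AT THE ROD: `m C_R () = e^{−R₀·d_k(C_R)} = e^{−R₀}` with `R₀ = R₀N L = 64 log 162 + (r+R)·a236 L∕L > 0` (W59.1's `hrate2_N_eq` — S44's
  `hrate2` WITH EQUALITY at pv22's (2.36) factor `ℓ = L∕a236 L`), hence `m C_R () < 1 = m C_L ()`: the (2.36)∕(2.35) transfer term is EXERCISED (tree length
  `1`, PART 1), where W59's centre cube met it as `ℓ·0 ≤ 0`.
* §2 S44's `hadm` MET for PART 1's index `termsR` = {`coveredR := ⟨∅, ⟨{X₀}, ↦ ⟨C_R, ()⟩⟩⟩`, W59's `uncoveredN`} at `X₀` (`tclosureDom_CR`, PART 1).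
* §3 the majorants: `maj coveredR = ε·e^{−R₀}` — STRICTLY BELOW W59's `maj coveredN = ε` (`majN_coveredR_lt`: the transfer is PRICED); `Σ_l maj l = ε·e^{−R₀} + v`.
* §4 `hAmp` MET for the rod's index (W35 `letterMass_coreW`, W41 `budget_half` BY NAME) and, for PART 1's activity `actR`, **S44's END FIRES** (`nestedToriRodEnd_fires`,
  `hL : 5 ≤ L` feeding S44's `3 ≤ L`; every other binder exactly as in W59.1's `nestedToriEnd_fires`, `hlink := link_torus' 4 N′`); closed form `≤ K₀(64,8)`.
* §5 LIVENESS: the activity at `X₀` in closed form (ONE common integral, W41 `termAt_coreW_pencil`), nonzero attached part (W33 `integral_incr_pos`), norm `< 1`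
  on `‖s‖ ≤ 2`, so the END's bounded quantity is NOT zero (W24 `exp_locE_cube`); closing `example` at `L = 5` (the least admitted here) and `L = 13`
  ([Balaban1987RGI] p. 251 «L an odd positive integer > 11» — TYPE only).

HONEST FRAMING.  A DECIDED TOY over HYPOTHESIS SHAPES + by-name composition ([folklore]∕[arith]); the rod, the rates and every numeral (`64·log 162`, `K₀(64,8)`,
`e^{−5R}∕64`, `α₆F∕(3⁴L⁴K₀e^{5R})`, `A∕4`) are OURS in S44's literal currency; `hinner` is CHOSEN (an equality by fiat in N0u's shape), NOT derived from a
density (S41); the transfer enters ONLY through `R₀N` times the rod's tree length `1`; (B1b) NOT claimed; (B3-amp) MET by CHOSEN weights — UNPRINTED for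
Bałaban's cores (G-ne9p2-5); print's ½L, (L+2)⁴, «L odd > 11», (1.28), (2.35)–(2.39) of [Balaban1988RGII] are TYPE∕CONTEXT only; WHICH tori are Bałaban's =
pv22's READING (D-pv22.3); no numeral of the audited manuscripts is asserted as a fact about Bałaban's densities; 0 binders instantiated on Bałaban's
densities; discharges no wall item; wall v1.8 (T4-DAG v48) — words, not kind — does NOT move; R-t4r2-Q2 NOT met; NE1′ ⇐ the named binders — NOT proved, NOT
printed; spine PROVED 0∕9; count 9 unchanged; 0 sorry, 0 `def … : Prop`, 0 cite; ABSOLUTE RULE honoured.  Rung (B)+1 on ONE finite four-torus — NOT infinite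
volume, NOT a mass gap, NOT OS on ℝ⁴, NOT Clay.  HONEST DEPENDENCY: continuum YM on T⁴ ⇐ BetaPertH ∧ nine spine estimates (0/9 proved); BetaPertH ⇐ (D1) ∧
(D4) ∧ CAP+tail; G-an2-4 gates asym, D1 and NE2/3/4.
-/

noncomputable section

namespace Summit.QuantumFields.BalabanUV.T4Continuum.NE1p.DressedSmallFieldNestedToriRodWitness

open Set Metric MeasureTheory Complex
open scoped BigOperators
open Literature.MathematicalPhysics.QuantumFieldTheory.Balaban1983to89
open Literature.MathematicalPhysics.QuantumFieldTheory.Balaban1983to89.B12TreeDecay (K₀ K₀_pos)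
open Literature.MathematicalPhysics.QuantumFieldTheory.Balaban1983to89.B13Resummation (locE)
open Literature.MathematicalPhysics.QuantumFieldTheory.Balaban1983to89.B13FamilySum (coveringFamilies mem_coveringFamilies)
open Literature.MathematicalPhysics.QuantumFieldTheory.Balaban1983to89.TreeLengthTorus (TPt TDom tsys torusTreeLen)
open Literature.MathematicalPhysics.QuantumFieldTheory.Balaban1983to89.TreeLengthTorusGeometry (tgeometry TTouch)
open Literature.MathematicalPhysics.QuantumFieldTheory.Balaban1983to89.TreeLengthTorusTransfer (tclosureDom)
open Summit.QuantumFields.BalabanUV.T4Continuum.B13HistMeasurable (B13HistM)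
open Summit.QuantumFields.BalabanUV.T4Continuum.B13HistWitness (toyFrame)
open Summit.QuantumFields.BalabanUV.T4Continuum.NE1p.DressedSmallFieldTorusWitness (X₀ X₀_val hrate_torus_num dressedConst_le_one exp_locE_cube)
open Summit.QuantumFields.BalabanUV.T4Continuum.NE1p.DressedSmallFieldCoresWitness (E1 crd liveTable norm_liveTable_le coreW N₁_coreW ctr0 hroom0
  Acst Acst_pos incr integral_incr_pos)
open Summit.QuantumFields.BalabanUV.T4Continuum.NE1p.DressedSmallFieldCoresMassWitness (letterMass_coreW cM cM_pos)
open Summit.QuantumFields.BalabanUV.T4Continuum.NE1p.DressedSmallFieldDepCoresWitness (budget_half termAt_coreW_pencil closedForm_real_sub_zero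
  norm_term_le)
open Summit.QuantumFields.BalabanUV.T4Continuum.NE1p.DressedSmallFieldInnerLink (link_torus')
open Summit.QuantumFields.BalabanUV.T4Continuum.NE1p.DressedSmallFieldInnerLabelsWitness (coveringFamilies_emptyFootprint)
open Summit.QuantumFields.BalabanUV.T4Continuum.NE1p.DressedSmallFieldNestedTori (attachedPart_locE_le_of_coresAt_pencil_components_nestedTori)
open Summit.QuantumFields.BalabanUV.T4Continuum.NE1p.DressedSmallFieldNestedToriWitness (rN RN vN R₀N εN εN_pos vN_pos hκ_N_eq hRR_N_eq
  hrate2_N_eq hκR_N h229_N_eq hsmall_N mN mN_nonneg hinner_N_eq LabelN coveredN uncoveredN majN majN_nonneg majN_coveredN majN_uncoveredN cN GN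
  GN_apply εN_le_one vN_le)
open Summit.QuantumFields.BalabanUV.T4Continuum.NE1p.DressedSmallFieldNestedToriRod (CR tclosureDom_CR torusTreeLen_CR coveredR
  coveredR_ne_uncoveredN termsR termsR_X₀ actR)

section Datum
variable (L N' : ℕ) [NeZero L] [NeZero N']

/-! ## §1 THE INNER WEIGHT AT THE ROD: the (2.36)∕(2.35) transfer term is exercised -/

omit [NeZero L] in
/-- `0 < R₀` (`64·log 162 > 0` and W59.1's `hκR_N`). [arith] -/
theorem R₀N_pos (hL : 5 ≤ L) : 0 < R₀N L :=
  lt_of_lt_of_le (by have := Real.log_pos (by norm_num : (1 : ℝ) < 162); positivity) (hκR_N L (by omega))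

/-- **THE INNER WEIGHT AT THE ROD IS `e^{−R₀}`** (tree length `1`, PART 1's `torusTreeLen_CR`). [arith] -/
theorem mN_CR (hL : 5 ≤ L) (u : Unit) : mN L N' (CR L N') u = Real.exp (-R₀N L) := by
  unfold mN; rw [torusTreeLen_CR L N' hL, mul_one]

/-- … STRICTLY BELOW `1` — where W59's centre cube had weight `e^{−R₀·0} = 1`: the transfer is EXERCISED. [arith] -/
theorem mN_CR_lt_one (hL : 5 ≤ L) (u : Unit) : mN L N' (CR L N') u < 1 := by
  rw [mN_CR L N' hL]; exact Real.exp_lt_one_iff.2 (by linarith [R₀N_pos L hL])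

/-! ## §2 S44's `hadm` MET for PART 1's index -/

open Classical in
/-- **S44's `hadm` MET**, third clause included: the ROD is in the closure fibre of `X₀` — `tclosureDom L N′ C_R = X₀ N′` (PART 1, `5 ≤ L`). [folklore] -/
theorem hadm_R (hL : 5 ≤ L) : ∀ Z : (tsys 4 N').Dom, ∀ l ∈ termsR L N' Z, l.1 ⊆ Z.1 ∧
    l.2.1 ∈ coveringFamilies Finset.univ (fun Y : (tsys 4 N').Dom => Y.1) (Z.1 \ l.1) ∧
    ∀ Z' (h : Z' ∈ l.2.1), l.2.2 Z' h ∈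
      ((Finset.univ : Finset (tsys 4 (L * N')).Dom).filter (fun Z₀ => tclosureDom L N' Z₀ = Z')).sigma (fun _ => (Finset.univ : Finset Unit)) := by
  intro Z l hl
  unfold termsR at hl
  split_ifs at hl with hZ
  · subst hZ
    rcases Finset.mem_insert.1 hl with rfl | hl'
    · refine ⟨Finset.empty_subset _, ?_, fun Z' h => ?_⟩
      · show ({X₀ N'} : Finset (TDom 4 N')) ∈ coveringFamilies Finset.univ (tgeometry 4 N').cubes ((X₀ N').1 \ ∅)
        rw [Finset.sdiff_empty]
        exact mem_coveringFamilies.2 ⟨Finset.subset_univ _, Finset.singleton_biUnion⟩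
      · have hZ' : Z' = X₀ N' := Finset.mem_singleton.1 h
        subst hZ'
        exact Finset.mem_sigma.2 ⟨Finset.mem_filter.2 ⟨Finset.mem_univ _, tclosureDom_CR L N' hL⟩, Finset.mem_univ _⟩
    · rw [Finset.mem_singleton] at hl'
      subst hl'
      refine ⟨subset_rfl, ?_, fun Z' h => absurd h (Finset.notMem_empty Z')⟩
      show (∅ : Finset (TDom 4 N')) ∈ coveringFamilies Finset.univ (tgeometry 4 N').cubes ((X₀ N').1 \ {0})
      rw [X₀_val, Finset.sdiff_self, coveringFamilies_emptyFootprint (tgeometry 4 N')]; exact Finset.mem_singleton_self _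
  · exact absurd hl (Finset.notMem_empty l)

/-! ## §3 THE MAJORANTS: the transfer is PRICED -/

/-- **THE ROD's COVERED LABEL WEIGHS `ε·e^{−R₀}`** (`#W′ = 0`, one member, the component of tree length `1`). [arith] -/
theorem majN_coveredR (hL : 5 ≤ L) : majN L N' (coveredR L N') = εN L * Real.exp (-R₀N L) := by
  unfold majN coveredR
  rw [Finset.card_empty, pow_zero, one_mul,
    Finset.prod_attach {X₀ N'} (fun _ => εN L * mN L N' (CR L N') ()), Finset.prod_singleton, mN_CR L N' hL]

/-- **THE PRICE OF THE TRANSFER**: the rod's covered label weighs STRICTLY LESS than W59's centre-cube covered label (`ε·e^{−R₀} < ε`). [arith] -/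
theorem majN_coveredR_lt (hL : 5 ≤ L) : majN L N' (coveredR L N') < majN L N' (coveredN L N') := by
  rw [majN_coveredR L N' hL, majN_coveredN]
  exact mul_lt_of_lt_one_right (εN_pos L) (Real.exp_lt_one_iff.2 (by linarith [R₀N_pos L hL]))

open Classical in
/-- **EXACTLY TWO LABELS AT THE COARSE UNIT BLOCK**. [folklore] -/
theorem termsR_X₀_card : (termsR L N' (X₀ N')).card = 2 := by
  rw [termsR_X₀, Finset.card_insert_of_notMem (by rw [Finset.mem_singleton]; exact coveredR_ne_uncoveredN L N'), Finset.card_singleton]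

open Classical in
/-- **THE MAJORANT MASS OF THE COARSE UNIT BLOCK**: `Σ_l maj l = ε·e^{−R₀} + v`. [arith] -/
theorem majR_sum_X₀ (hL : 5 ≤ L) : ∑ l ∈ termsR L N' (X₀ N'), majN L N' l = εN L * Real.exp (-R₀N L) + vN := by
  rw [termsR_X₀, Finset.sum_insert (by rw [Finset.mem_singleton]; exact coveredR_ne_uncoveredN L N'), Finset.sum_singleton,
    majN_coveredR L N' hL, majN_uncoveredN]

omit [NeZero N'] in
/-- `ε·e^{−R₀} + v ≤ 1 + 1∕64` (W59.2's `εN_le_one`, `vN_le`; `e^{−R₀} ≤ 1`). [arith] -/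
theorem majR_mass_le (hL : 5 ≤ L) : εN L * Real.exp (-R₀N L) + vN ≤ 1 + 1 / 64 := by
  have h1 : εN L * Real.exp (-R₀N L) ≤ εN L :=
    mul_le_of_le_one_right (εN_pos L).le (Real.exp_le_one_iff.2 (by linarith [R₀N_pos L hL]))
  linarith [εN_le_one L, vN_le]

/-! ## §4 `hAmp` MET AND THE END FIRES (S44's END applied ONCE BY NAME) -/

variable (r : ℝ) (hr : 0 ≤ r)

/-- **`hAmp` MET FOR EVERY SUB-POLYMER AND EVERY LABEL OF THE ROD's INDEX** [decided toy], in S44's LITERAL binder shape (W35 `letterMass_coreW`, W41 `budget_half`;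
W59.1's `hAmp_N` is the same computation over W59's index). [folklore] -/
theorem hAmp_R (k : ℕ) :
    ∀ Z : (tsys 4 N').Dom, Z.1 ⊆ (X₀ N').1 → ∀ l ∈ termsR L N' Z,
      (GN L N' r hr k l k).lam.real univ *
          ((GN L N' r hr k l k).wB * (fun (_ : ℕ) (_ : LabelN L N') (_ : ℕ) => (1 : ℝ)) k l k *
            Real.exp ((fun (_ : ℕ) (_ : LabelN L N') (_ : ℕ) => (0 : ℝ)) k l k)) *
          (Real.pi / ((fun (_ : ℕ) (_ : LabelN L N') (_ : ℕ) => (1 : ℝ)) k l k / 2)) ^ (Module.finrank ℝ E1 / 2 : ℝ) *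
        Real.exp ((GN L N' r hr k l k).N₁ * (‖(0 : B13HistM toyFrame)‖ + 2 * ‖liveTable‖)) ≤
      (0 + 2 * (Acst / 4)) * (vN ^ l.1.card * ∏ x ∈ l.2.1.attach, (εN L * mN L N' (l.2.2 x.1 x.2).1 (l.2.2 x.1 x.2).2)) := by
  intro Z _ l _
  simp only [GN_apply]
  rw [letterMass_coreW, N₁_coreW, norm_zero, zero_add]
  have hp : 0 ≤ majN L N' l := majN_nonneg L N' l
  have hT : 2 * ‖liveTable‖ ≤ 2 := by linarith [norm_liveTable_le]
  have hb := budget_half r hr hT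
  show |cN L N' r l| * Real.sqrt (2 * Real.pi) * Real.exp (r * (2 * ‖liveTable‖)) ≤ (0 + 2 * (Acst / 4)) * majN L N' l
  unfold cN
  rw [abs_mul, abs_of_nonneg hp]
  calc |cM r / 2| * majN L N' l * Real.sqrt (2 * Real.pi) * Real.exp (r * (2 * ‖liveTable‖))
      = majN L N' l * (|cM r / 2| * Real.sqrt (2 * Real.pi) * Real.exp (r * (2 * ‖liveTable‖))) := by ring
    _ ≤ majN L N' l * (Acst / 2) := mul_le_mul_of_nonneg_left hb hp
    _ = (0 + 2 * (Acst / 4)) * majN L N' l := by ring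

open Classical in
/-- **S44's `attachedPart_locE_le_of_coresAt_pencil_components_nestedTori` FIRES ON THE ROD DATUM** [decided toy]: every binder as in W59.1's
`nestedToriEnd_fires` (coarse torus `tsys 4 N′`, FINE torus `tsys 4 (L·N′)`, closure `tclosureDom L N′`, `I := univ : Finset Unit`, `m := mN`, `bsel := (·).2.1.choose`,
`(ε, c₀, R₀, r, R, c′, v) := (εN, 0, R₀N, rN, RN, 5, vN)` with W59.1's equalities, `hlink := link_torus' 4 N′`), EXCEPT the index `termsR`, the activity `actR`,
`hadm_R` (the ROD's closure) and `hAmp_R`; `5 ≤ L` feeds S44's `3 ≤ L`. Conclusion LITERAL. [folklore] -/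
theorem nestedToriRodEnd_fires (hL : 5 ≤ L) (k : ℕ) :
    ‖locE (TTouch (d := 4) (N := N')) (fun Z : (tsys 4 N').Dom => Z.1) (actR L N' r hr k 1) (X₀ N').1 -
        locE (TTouch (d := 4) (N := N')) (fun Z : (tsys 4 N').Dom => Z.1) (actR L N' r hr k 0) (X₀ N').1‖ ≤
      4 * (Real.exp 1 * 9 * 64 * K₀ 64 8 ^ 2) * (Acst / 4) * Real.exp (-(0 * torusTreeLen (X₀ N').1)) :=
  have h3 : 3 ≤ L := by omega
  attachedPart_locE_le_of_coresAt_pencil_components_nestedTori h3 (GN L N' r hr)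
    (Win := Set.univ) (ctr := ctr0) (ROp := fun _ => 1) (RHist := fun _ => 2) (R' := fun _ => 2)
    (mq := fun _ _ _ => 1) (bq := fun _ _ _ => 0) (N₀ := fun _ _ _ => 1)
    hroom0 (fun _ _ _ _ _ _ _ => one_pos)
    (fun _ _ _ _ _ _ _ => ⟨fun _ _ => aestronglyMeasurable_const, fun _ => differentiableOn_const _, fun _ _ _ => by
      show ‖(1 : ℂ)‖ ≤ 1; rw [norm_one]⟩)
    (fun _ _ _ _ _ _ _ => ⟨fun _ _ => (Complex.measurable_ofReal.comp (measurable_snd.norm.pow_const 2)).aestronglyMeasurable,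
      fun _ _ => differentiableOn_const _, fun _ _ _ v => by
        show 1 * ‖v‖ ^ 2 - 0 ≤ (((‖v‖ ^ 2 : ℝ) : ℂ)).re; rw [Complex.ofReal_re]; simp⟩)
    (g := fun _ => 0) (Set.mem_univ _) (U := ()) (o := 0) (h₀ := 0) (w := liveTable) (ϱ := 2)
    (by show ‖(0 : ℂ) - 0‖ ≤ 1; simp)
    (by show ‖(0 : B13HistM toyFrame) - 0‖ + 2 * ‖liveTable‖ ≤ 2; rw [sub_zero, norm_zero, zero_add];
        linarith [norm_liveTable_le])
    (emb := fun _ => k) (fun _ => rfl) (terms := termsR L N') (act := actR L N' r hr k) (fun _ _ _ => rfl)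
    (A₀ := 0) (A₁ := Acst / 4) (r₁ := 0) (X₀ N')
    le_rfl (by have := Acst_pos; positivity) le_rfl hrate_torus_num hsmall_N
    (fun _ => (Finset.univ : Finset Unit)) (mN L N') (mN_nonneg L N') (fun Z' => Z'.2.1.choose) (fun Z' => Z'.2.1.choose_spec)
    (ε := εN L) (c₀ := 0) (R₀ := R₀N L) (r := rN) (R := RN) (c' := 5) (v := vN)
    (εN_pos L).le vN_pos.le (fun Z₀ => (hinner_N_eq L N' Z₀).le) (hκR_N L h3) (hrate2_N_eq L h3).le hκ_N_eq.le (h229_N_eq L).le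
    (link_torus' 4 N') hRR_N_eq.le (hadm_R L N' hL) (hAmp_R L N' r hr k) le_rfl (by have := Acst_pos; linarith)

open Classical in
/-- … in CLOSED FORM: `≤ K₀(64,8)`. [folklore] -/
theorem nestedToriRodEnd_fires_closed (hL : 5 ≤ L) (k : ℕ) :
    ‖locE (TTouch (d := 4) (N := N')) (fun Z : (tsys 4 N').Dom => Z.1) (actR L N' r hr k 1) (X₀ N').1 -
        locE (TTouch (d := 4) (N := N')) (fun Z : (tsys 4 N').Dom => Z.1) (actR L N' r hr k 0) (X₀ N').1‖ ≤ K₀ 64 8 := by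
  refine (nestedToriRodEnd_fires L N' r hr hL k).trans (le_of_eq ?_)
  rw [zero_mul, neg_zero, Real.exp_zero, mul_one]
  unfold Acst
  have hK := K₀_pos (64 : ℝ) 8
  have he := Real.exp_pos 1
  field_simp

/-! ## §5 LIVENESS: the END's bounded quantity is NOT zero on the rod datum -/

open Classical in
/-- **THE ACTIVITY AT `X₀` IN CLOSED FORM**: `actR k s X₀ = (cM r∕2)·(ε·e^{−R₀} + v)·∫ e^{s·r·e^{−(v 0)²}}·e^{−‖v‖²} dv` (W41 `termAt_coreW_pencil`, ONE common
integral; `majR_sum_X₀`). [folklore] -/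
theorem actR_X₀ (hL : 5 ≤ L) (k : ℕ) (s : ℂ) :
    actR L N' r hr k s (X₀ N') = ((cM r / 2 * (εN L * Real.exp (-R₀N L) + vN) : ℝ) : ℂ) *
      ∫ v : E1, cexp (s * ((r : ℂ) * (Real.exp (-(crd v ^ 2)) : ℂ))) * cexp (-(((‖v‖ ^ 2 : ℝ) : ℂ))) := by
  unfold actR
  simp only [GN_apply, termAt_coreW_pencil]
  rw [← Finset.sum_mul, ← majR_sum_X₀ L N' hL, Finset.mul_sum]
  push_cast
  unfold cN
  push_cast
  rfl

/-- The increment between a REAL source `t` and `0` at `X₀` (W41 `closedForm_real_sub_zero`). [folklore] -/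
theorem actR_real_sub_zero (hL : 5 ≤ L) (k : ℕ) (t : ℝ) :
    actR L N' r hr k (t : ℂ) (X₀ N') - actR L N' r hr k 0 (X₀ N') =
      ((cM r / 2 * (εN L * Real.exp (-R₀N L) + vN) : ℝ) : ℂ) * ((∫ v, incr (t * r) v : ℝ) : ℂ) := by
  rw [actR_X₀ L N' r hr hL, actR_X₀ L N' r hr hL]
  exact closedForm_real_sub_zero _ r hr t

/-- **THE ATTACHED PART OF THE ACTIVITY IS NOT ZERO** (`(cM r∕2)(ε·e^{−R₀} + v) > 0`, W33's `∫ incr r > 0` for `0 < r`). [folklore] -/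
theorem actR_live (hL : 5 ≤ L) (hr0 : 0 < r) (k : ℕ) : actR L N' r hr k 1 (X₀ N') ≠ actR L N' r hr k 0 (X₀ N') := by
  intro h
  have h0 := sub_eq_zero.2 h
  rw [show (1 : ℂ) = ((1 : ℝ) : ℂ) from Complex.ofReal_one.symm, actR_real_sub_zero L N' r hr hL, one_mul] at h0
  have hc : 0 < cM r / 2 * (εN L * Real.exp (-R₀N L) + vN) :=
    mul_pos (half_pos (cM_pos r)) (by have := mul_pos (εN_pos L) (Real.exp_pos (-R₀N L)); linarith [vN_pos])
  rcases mul_eq_zero.1 h0 with hc0 | hI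
  · exact hc.ne' (by exact_mod_cast hc0)
  · exact (integral_incr_pos r hr0).ne' (by exact_mod_cast hI)

/-- The activities at `X₀` lie STRICTLY inside the unit disc for `‖s‖ ≤ 2` (`ε·e^{−R₀} + v ≤ 65∕64`, W41 `norm_term_le`, `A ≤ 1`, `√π∕√(2π) < 1`). [folklore] -/
theorem norm_actR_X₀_lt_one (hL : 5 ≤ L) (k : ℕ) {s : ℂ} (hs : ‖s‖ ≤ 2) : ‖actR L N' r hr k s (X₀ N')‖ < 1 := by
  rw [actR_X₀ L N' r hr hL]
  have hp0 : 0 ≤ εN L * Real.exp (-R₀N L) + vN := by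
    have := mul_pos (εN_pos L) (Real.exp_pos (-R₀N L)); linarith [vN_pos]
  have hp1 := majR_mass_le L hL
  have hπ : 0 < Real.sqrt Real.pi := Real.sqrt_pos.2 Real.pi_pos
  have hlt : Real.sqrt Real.pi < Real.sqrt (2 * Real.pi) := Real.sqrt_lt_sqrt Real.pi_pos.le (by linarith [Real.pi_pos])
  have hq : Real.sqrt Real.pi / Real.sqrt (2 * Real.pi) < 1 := (div_lt_one (hπ.trans hlt)).2 hlt
  have hq0 : 0 ≤ Real.sqrt Real.pi / Real.sqrt (2 * Real.pi) := by positivity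
  have hA : Acst ≤ 1 := dressedConst_le_one
  have hb := norm_term_le r hr hs
  have hn : ‖((cM r / 2 * (εN L * Real.exp (-R₀N L) + vN) : ℝ) : ℂ) *
        ∫ v : E1, cexp (s * ((r : ℂ) * (Real.exp (-(crd v ^ 2)) : ℂ))) * cexp (-(((‖v‖ ^ 2 : ℝ) : ℂ)))‖ =
      (εN L * Real.exp (-R₀N L) + vN) * ‖((cM r / 2 : ℝ) : ℂ) *
        ∫ v : E1, cexp (s * ((r : ℂ) * (Real.exp (-(crd v ^ 2)) : ℂ))) * cexp (-(((‖v‖ ^ 2 : ℝ) : ℂ)))‖ := by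
    rw [norm_mul, norm_mul, Complex.norm_real, Complex.norm_real, Real.norm_eq_abs, Real.norm_eq_abs, abs_mul, abs_of_nonneg hp0]
    ring
  rw [hn]
  calc (εN L * Real.exp (-R₀N L) + vN) * ‖((cM r / 2 : ℝ) : ℂ) *
          ∫ v : E1, cexp (s * ((r : ℂ) * (Real.exp (-(crd v ^ 2)) : ℂ))) * cexp (-(((‖v‖ ^ 2 : ℝ) : ℂ)))‖
      ≤ (1 + 1 / 64) * (Acst / 2 * (Real.sqrt Real.pi / Real.sqrt (2 * Real.pi))) := mul_le_mul hp1 hb (norm_nonneg _) (by norm_num)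
    _ < 1 := by
        have := Acst_pos
        nlinarith

open Classical in
/-- **THE END's BOUNDED QUANTITY IS NOT ZERO ON THE ROD DATUM** [decided toy]: equal dressed outputs on the coarse unit block would give equal activities
at `X₀` (W24's `exp_locE_cube` BY NAME), contradicting `actR_live`. [folklore] -/
theorem nestedToriRodEnd_live (hL : 5 ≤ L) (hr0 : 0 < r) (k : ℕ) :
    locE (TTouch (d := 4) (N := N')) (fun Z : (tsys 4 N').Dom => Z.1) (actR L N' r hr k 1) (X₀ N').1 ≠
      locE (TTouch (d := 4) (N := N')) (fun Z : (tsys 4 N').Dom => Z.1) (actR L N' r hr k 0) (X₀ N').1 := by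
  intro h
  have h1 := exp_locE_cube N' (w := actR L N' r hr k 1) (norm_actR_X₀_lt_one L N' r hr hL k (by simp))
  have h0 := exp_locE_cube N' (w := actR L N' r hr k 0) (norm_actR_X₀_lt_one L N' r hr hL k (by simp))
  have h' : cexp (locE (TTouch (d := 4) (N := N')) (fun Z : (tsys 4 N').Dom => Z.1) (actR L N' r hr k 1) {0}) =
      cexp (locE (TTouch (d := 4) (N := N')) (fun Z : (tsys 4 N').Dom => Z.1) (actR L N' r hr k 0) {0}) := congrArg cexp h
  rw [h1, h0, add_right_inj] at h'
  exact actR_live L N' r hr hL hr0 k h'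

open Classical in
/-- **THE NESTED-TORI END FIRES ON A LIVE DATUM WHOSE COMPONENT HAS TREE LENGTH ONE**, at the least blocking factor admitted here `L = 5` (ℓ = 15∕13) AND at
print's least admitted one `L = 13` ([Balaban1987RGI] p.251 «L an odd positive integer > 11» — TYPE only; ℓ = 143∕37): bound ∧ liveness ∧ the price of the
transfer, on every coarse torus `N′`. [folklore] -/
example (hr0 : 0 < r) (k : ℕ) :
    (locE (TTouch (d := 4) (N := N')) (fun Z : (tsys 4 N').Dom => Z.1) (actR 5 N' r hr k 1) (X₀ N').1 ≠
        locE (TTouch (d := 4) (N := N')) (fun Z : (tsys 4 N').Dom => Z.1) (actR 5 N' r hr k 0) (X₀ N').1 ∧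
      ‖locE (TTouch (d := 4) (N := N')) (fun Z : (tsys 4 N').Dom => Z.1) (actR 5 N' r hr k 1) (X₀ N').1 -
          locE (TTouch (d := 4) (N := N')) (fun Z : (tsys 4 N').Dom => Z.1) (actR 5 N' r hr k 0) (X₀ N').1‖ ≤ K₀ 64 8 ∧
      majN 5 N' (coveredR 5 N') < majN 5 N' (coveredN 5 N')) ∧
    (locE (TTouch (d := 4) (N := N')) (fun Z : (tsys 4 N').Dom => Z.1) (actR 13 N' r hr k 1) (X₀ N').1 ≠
        locE (TTouch (d := 4) (N := N')) (fun Z : (tsys 4 N').Dom => Z.1) (actR 13 N' r hr k 0) (X₀ N').1 ∧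
      ‖locE (TTouch (d := 4) (N := N')) (fun Z : (tsys 4 N').Dom => Z.1) (actR 13 N' r hr k 1) (X₀ N').1 -
          locE (TTouch (d := 4) (N := N')) (fun Z : (tsys 4 N').Dom => Z.1) (actR 13 N' r hr k 0) (X₀ N').1‖ ≤ K₀ 64 8) :=
  ⟨⟨nestedToriRodEnd_live 5 N' r hr (by norm_num) hr0 k, nestedToriRodEnd_fires_closed 5 N' r hr (by norm_num) k,
    majN_coveredR_lt 5 N' (by norm_num)⟩,
   ⟨nestedToriRodEnd_live 13 N' r hr (by norm_num) hr0 k, nestedToriRodEnd_fires_closed 13 N' r hr (by norm_num) k⟩⟩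

end Datum

end Summit.QuantumFields.BalabanUV.T4Continuum.NE1p.DressedSmallFieldNestedToriRodWitness

end
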